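import Summits.AtomisticToContinuum.HydrodynamicLimit.Theorems.RelayRaceLocalityNearConstantShortTimeHLGoodEventPackagePX
import Summits.AtomisticToContinuum.HydrodynamicLimit.Theorems.RelayRaceLocalityNearConstantShortTimeHLEntropyPricePackage
import Summits.AtomisticToContinuum.HydrodynamicLimit.Theorems.RelayRaceLocalityNearConstantShortTimeHLGronwallCells
import Summits.AtomisticToContinuum.HydrodynamicLimit.Theorems.RelayRaceLocalityNearConstantShortTimeHLLogProfileObsBounds
import Summits.AtomisticToContinuum.HydrodynamicLimit.Theorems.RelayRaceLocalityNearConstantShortTimeHLFluctuationTools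
import Summits.AtomisticToContinuum.HydrodynamicLimit.Theorems.RelayRaceLocalityNearConstantShortTimeHLGaussianTail
import Summits.AtomisticToContinuum.HydrodynamicLimit.Theorems.RelayRaceLocalityNearConstantShortTimeHLMomentPackageE
import Summits.AtomisticToContinuum.HydrodynamicLimit.Theorems.RelayRaceLocalityNearConstantShortTimeHLMomentPackage
import Summits.AtomisticToContinuum.HydrodynamicLimit.Theorems.RelayRaceLocalityNearConstantShortTimeHLGridIncrements
import Summits.AtomisticToContinuum.HydrodynamicLimit.Theorems.RelayRaceLocalityNearConstantShortTimeHLGridCells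
import Summits.AtomisticToContinuum.HydrodynamicLimit.Theorems.RelayRaceLocalityNearConstantShortTimeHLDynLimits
import Summits.AtomisticToContinuum.HydrodynamicLimit.Theorems.RelayRaceLocalityNearConstantShortTimeHLDynamicDefs
import Summits.AtomisticToContinuum.HydrodynamicLimit.Theorems.RelayRaceLocalityNearConstantShortTimeHLExpTailDefs
import Summits.AtomisticToContinuum.HydrodynamicLimit.Theorems.RelayRaceLocalityNearConstantShortTimeHLExpCapDefs
import Summits.AtomisticToContinuum.HydrodynamicLimit.Theorems.RelayRaceLocalityNearConstantShortTimeHLPackQuarticDefs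
import Literature.Analysis.FluidPDE.CollisionalTransferMeasurable
import HarnessLib

/-!
# Crux `NearConstantShortTimeHL` (stmt-AtomisticToContinuum-12502), line `small-tilt-domination`, skeleton v24 (lead c9):
# `stub_dynamicPX : DynamicTheoremPX` — level 1 of the Grönwall assembly under the INTEGRATED EXPONENTIAL CAP

Support file (`--supports stmt-AtomisticToContinuum-12502`). Yau's relative-entropy Grönwall at fixed data in the currency of skeleton
v24: the typed statement `DynamicTheoremPX` (`…ExpCapDefs`) is `DynamicTheoremPE` (`…ExpTailDefs`) verbatim with (i) the integrated-cap
failure hypothesis re-typed to the exponential cap (`hcapX : ∀ K > 0, ∀ᶠ N, P N {ofReal K < ∫⁻_{[0,t]} n⁻¹ Σᵢ exp ‖vᵢ(r)‖} ≤ ofReal (C₄ / K)`)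
and (ii) the conjunct `intMomentCapOn …` REPLACED by `intExpCapOn …` in the events of the two equilibrium closure bounds `hKmom` / `hKen`.
The proof is the landed proof of `stub_dynamicPE` (`…DynamicPE`) VERBATIM with one change: the good events come from
`good_event_packagePX` (`…GoodEventPackagePX`: `good_event_packagePQ` with the cap swapped, the cap on `[0, t]` restricted to the windows /
cells by `intExpCapOn_mono`) instead of `good_event_packagePQ`; the rest of the assembly (the moment package `moment_packageE`, the choice
of the exponential rate `b := C_gi β t + 1` and of the cubic level `L` by `dyn_exists_levelE`, the entropy price, the grid inequalities,
the Grönwall step and the limits) never looks inside the cap and is untouched.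
References: H.-T. Yau, Lett. Math. Phys. 22 (1991) §2; B. Nachtergaele – H.-T. Yau, Comm. Math. Phys. 243 (2003) §7.2.
-/

noncomputable section

namespace Summit.AtomisticToContinuum.HydrodynamicLimit.Theorems.NearConstantShortTimeHL

open scoped BigOperators ENNReal
open MeasureTheory Set Filter Topology
open Literature.MathematicalPhysics.KineticTheory Literature.Analysis.FluidPDE Literature.Analysis.FunctionSpaces

/-! ## The assembly -/

/-- **`stub_dynamicPX : DynamicTheoremPX`** (registered stub of skeleton v24, level 1 of the Grönwall assembly): Yau's relative-entropy
Grönwall at fixed data under the integrated EXPONENTIAL cap and super-exponential velocity tails in mean along the true law — the landed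
proof of `stub_dynamicPE` verbatim over `good_event_packagePX` (and `moment_packageE`, with the cubic level `L` chosen by `dyn_exists_levelE`
after the exponential rate `b = C_gi γ⁻¹ t + 1`), then pushed to the limit (`κ₁`, `M′`, `N`). [cite: Yau1991, §2] -/
theorem stub_dynamicPX : DynamicTheoremPX := by
  intro η₀ F hη₀ hFa hEq σ T hσ ρ θ u hE t ht ht1 hband hmass ηP hηP hηP₀ ε n hn hε Φ P hPdef hP π₀ πst hπ₀ hπ hm₀ hm₀i hiso
    γ hγ hSt2 hcapP C₄ hC₄ hcapX hexpm G aI c₀ haI hImp η₂ η₃ hη₂ hη₃ hKmom hKen κ hκ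
  -- notation: the Euler entropy functional `H` and the defect `D`
  set H : ℝ → ℝ := fun r => ∫ x, ρ r x * (Real.log (ρ r x) + gChem σ (ρ r x) - 3 / 2 * Real.log (2 * Real.pi * θ r x) - 3 / 2)
    with hH_def
  have hT0 : 0 < T := lt_of_le_of_lt ht.1 ht.2
  have hac : ∀ N, P N ≪ liouville (Torus.geometry (Fin 3)) (n N) (ε N) := fun N => by
    rw [hPdef N]; exact withDensity_absolutelyContinuous _ _
  have hgoodae : ∀ N, ∀ᵐ z ∂P N, z ∈ (Φ N).good := fun N =>
    (HardSphereFlow.measure_compl_good_of_absolutelyContinuous (Φ N) (hac N) : P N (Φ N).goodᶜ = 0)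
  -- the entropy price (also gives the integrability clause)
  have hepp := entropy_price_package hη₀ hFa hEq hσ hE ht hband hn hε Φ P hPdef hP hπ₀ hπ hm₀ hm₀i hiso hγ hSt2
  ------------------------------------------------------------------
  -- Case `t = 0`
  ------------------------------------------------------------------
  rcases ht.1.eq_or_lt with ht0 | ht0
  · subst ht0
    have h1 := hepp κ hκ
    have h2 : ∀ᶠ N : ℕ in atTop, H 0 - κ ≤ ∫ z, logProfileObs σ ρ θ u 0 z ∂P N := by
      have := hm₀.eventually (eventually_gt_nhds (show H 0 - κ < H 0 by linarith))
      exact this.mono fun N h => h.le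
    filter_upwards [h1, h2] with N h1 h2
    have h0 : (0 : ℝ) ∈ Set.Icc (0 : ℝ) 0 := ⟨le_rfl, le_rfl⟩
    refine ⟨(h1 0 h0).1, ?_⟩
    have e : ∫ z, logProfileObs σ ρ θ u 0 ((Φ N).flow 0 z) ∂P N = ∫ z, logProfileObs σ ρ θ u 0 z ∂P N :=
      integral_congr_ae ((hgoodae N).mono fun z hz => by simp only [(Φ N).flow_zero z hz])
    rw [e]; exact h2
  ------------------------------------------------------------------
  -- Case `0 < t`: the packages
  ------------------------------------------------------------------
  obtain ⟨Λ, hΛ, ι, hι, G', hG'm, hG'c, hgood⟩ := good_event_packagePX hη₀ hFa hEq hσ hE ht ht0 ht1 hband hn Φ P G haI hImp hη₂ hη₃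
    hKmom hKen hcapP hC₄ hcapX
  obtain ⟨CK, hCK, C3, hC3, hmomN, hcubic, htail⟩ := moment_packageE hE hT0 Φ P hPdef hP hexpm
  obtain ⟨CX, hCX, hCXb⟩ := abs_logProfileObs_le hη₀ hFa hEq hσ hE ht hband
  obtain ⟨Cgi, hCgi, hgi⟩ := grid_increments hη₀ hFa hEq hσ hE ht ht0 hband hηP hηP₀
  obtain ⟨Cgc, hCgc, hgc⟩ := grid_cells hη₀ hFa hEq hσ hE ht ht0 hband hηP hηP₀
  ------------------------------------------------------------------
  -- constants: `β = γ⁻¹`, the exponential rate `b` (chosen AFTER `Cgi β t`), the cubic level `L`, `β'`, `Tl`, `κ₁`, `M'`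
  ------------------------------------------------------------------
  set β : ℝ := γ⁻¹ with hβ_def
  have hβ0 : 0 < β := inv_pos.2 hγ
  set b : ℝ := Cgi * β * t + 1 with hb_def
  have hb0 : 0 < b := by positivity
  obtain ⟨A2, hA2, htail2⟩ := htail b hb0
  obtain ⟨L, -, hL1, hLsmall⟩ := dyn_exists_levelE (Cgi * β * t) (Cgi * t * (6 / b ^ 3 * A2)) 1 (κ / 8)
    (by positivity) (by positivity)
  set β' : ℝ := Cgi * (1 + L) * β with hβ'_def
  have hβ'0 : 0 ≤ β' := by positivity
  set Tl : ℝ := 6 / b ^ 3 * Real.exp (-(b * L)) * A2 with hTl_def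
  have hTl0 : 0 ≤ Tl := by positivity
  set X : ℝ := Real.exp (β' * t) with hX_def
  have hX1 : 1 ≤ X := Real.one_le_exp (by positivity)
  have hX0 : 0 < X := by positivity
  have hLsmall' : Cgi * t * Tl * X ≤ κ / 8 := by
    have e : Cgi * t * Tl * X =
        Cgi * t * (6 / b ^ 3 * A2) * Real.exp (-((Cgi * β * t + 1) * L)) * Real.exp (Cgi * β * t * (1 + L)) := by
      rw [hTl_def, hX_def, hβ'_def, hb_def]; ring_nf
    rw [e]; exact hLsmall
  set κ₁ : ℝ := κ / (8 * (Cgi * (1 + L) * β * t * X + 1)) with hκ₁_def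
  have hκ₁0 : 0 < κ₁ := by positivity
  have hκ₁small : Cgi * (1 + L) * β * κ₁ * t * X ≤ κ / 8 := by
    have hden : 0 < Cgi * (1 + L) * β * t * X + 1 := by positivity
    have e : Cgi * (1 + L) * β * κ₁ * t * X = (κ / 8) * ((Cgi * (1 + L) * β * t * X) / (Cgi * (1 + L) * β * t * X + 1)) := by
      rw [hκ₁_def]; field_simp
    rw [e]
    have : (Cgi * (1 + L) * β * t * X) / (Cgi * (1 + L) * β * t * X + 1) ≤ 1 := by
      rw [div_le_one hden]; linarith
    calc (κ / 8) * ((Cgi * (1 + L) * β * t * X) / (Cgi * (1 + L) * β * t * X + 1)) ≤ (κ / 8) * 1 :=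
          mul_le_mul_of_nonneg_left this (by positivity)
      _ = κ / 8 := mul_one _
  set cG : ℝ := 2 * CX * (1 + β' * t) * X with hcG_def
  have hcG0 : 0 < cG := by positivity
  set M' : ℝ := 8 * cG * CK / κ + 1 with hM'_def
  have hM'0 : 0 < M' := by positivity
  have hM'small : cG * (CK / M') ≤ κ / 8 := by
    rw [mul_div_assoc', div_le_iff₀ hM'0, hM'_def]
    have : κ / 8 * (8 * cG * CK / κ + 1) = cG * CK + κ / 8 := by field_simp
    rw [this]; linarith
  ------------------------------------------------------------------
  -- the vanishing remainder
  ------------------------------------------------------------------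
  set pG : ℕ → ℝ := fun N => (P N (G' N)ᶜ).toReal with hpG_def
  have hpG : Tendsto pG atTop (𝓝 0) := by
    have := (ENNReal.tendsto_toReal ENNReal.zero_ne_top).comp hG'c
    rw [ENNReal.toReal_zero] at this
    exact this
  set dd : ℕ → ℝ := fun N => 2 * Λ / ((ι N : ℝ) + 1) ^ 2 with hdd_def
  obtain ⟨hdd, hιdd⟩ := dyn_tendsto_defect hι (2 * Λ)
  have hω := dyn_tendsto_inv_succ hι
  have hτ := dyn_tendsto_const_div hι t
  set D0 : ℕ → ℝ := fun N => max 0 (H 0 - ∫ z, logProfileObs σ ρ θ u 0 ((Φ N).flow 0 z) ∂P N) with hD0_def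
  have hD0 : Tendsto D0 atTop (𝓝 0) := by
    have h1 : Tendsto (fun N => H 0 - ∫ z, logProfileObs σ ρ θ u 0 ((Φ N).flow 0 z) ∂P N) atTop (𝓝 (H 0 - H 0)) := by
      refine tendsto_const_nhds.sub (hm₀.congr fun N => ?_)
      exact (integral_congr_ae ((hgoodae N).mono fun z hz => by simp only [(Φ N).flow_zero z hz])).symm
    rw [sub_self] at h1
    have := h1.max (tendsto_const_nhds (x := (0 : ℝ)))
    rw [max_self] at this
    exact this.congr fun N => max_comm _ _
  set R : ℕ → ℝ := fun N => X * (D0 N + 2 * dd N + 6 * t * ((ι N : ℝ) + 1)⁻¹ * (1 + CK) + Cgi * t * pG N +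
      2 * CX * (1 + β' * t) * ((1 + M') * pG N) +
      β' * (Cgc * t * (t / ι N) + 2 * ((ι N : ℝ) * dd N) + Cgc * t * ((t / ι N) * (1 + CK) + (t / ι N) * C3))) with hR_def
  have hR : Tendsto R atTop (𝓝 0) := by
    have h : Tendsto (fun N => X * (D0 N + 2 * dd N + 6 * t * ((ι N : ℝ) + 1)⁻¹ * (1 + CK) + Cgi * t * pG N +
        2 * CX * (1 + β' * t) * ((1 + M') * pG N) +
        β' * (Cgc * t * (t / ι N) + 2 * ((ι N : ℝ) * dd N) + Cgc * t * ((t / ι N) * (1 + CK) + (t / ι N) * C3))))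
        atTop (𝓝 (X * (0 + 2 * 0 + 6 * t * 0 * (1 + CK) + Cgi * t * 0 + 2 * CX * (1 + β' * t) * ((1 + M') * 0) +
          β' * (Cgc * t * 0 + 2 * 0 + Cgc * t * (0 * (1 + CK) + 0 * C3))))) := by
      refine Tendsto.const_mul X ?_
      refine ((((hD0.add (hdd.const_mul 2)).add ((hω.const_mul (6 * t)).mul_const (1 + CK))).add (hpG.const_mul _)).add
        ((hpG.const_mul (1 + M')).const_mul _)).add (Tendsto.const_mul β' ?_)
      exact ((hτ.const_mul _).add (hιdd.const_mul 2)).add (((hτ.mul_const _).add (hτ.mul_const _)).const_mul _)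
    simpa using h
  have hRev : ∀ᶠ N : ℕ in atTop, R N ≤ κ / 2 := (hR.eventually (eventually_le_nhds (by positivity))).mono fun N h => h
  ------------------------------------------------------------------
  -- at a fixed large `N`
  ------------------------------------------------------------------
  have hn1 : ∀ᶠ N : ℕ in atTop, 1 ≤ n N := hn.eventually_ge_atTop 1
  have hLtail := htail2 L
  filter_upwards [hgood, hcubic, hLtail, hepp κ₁ hκ₁0, hRev, hn1] with N hgN hcubN htailN heppN hRN hn1N
  obtain ⟨hιN, hℓ0, hℓh, hmod, hGz⟩ := hgN
  obtain ⟨hK1, hK2, hKle, hKset⟩ := hmomN N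
  haveI : IsProbabilityMeasure (P N) := hP N
  have hn0 : n N ≠ 0 := by omega
  have hint : ∀ r ∈ Set.Icc 0 t, Integrable (fun z => logProfileObs σ ρ θ u r ((Φ N).flow r z)) (P N) := fun r hr => (heppN r hr).1
  refine ⟨(hint t ⟨ht.1, le_rfl⟩), ?_⟩
  have hmeas := measurable_logProfileObs_clamp hE ht (n := n N)
  obtain ⟨hKm, hTm, hnn⟩ := measurable_kineticPP_cubicTail (n := n N) L
  have hCXb' : ∀ r ∈ Set.Icc 0 t, ∀ w : Config (n N) (Fin 3) T3, |logProfileObs σ ρ θ u r w| ≤ CX * (1 + kineticPP w) :=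
    fun r hr w => hCXb r hr w
  have hωN : 0 ≤ ((ι N : ℝ) + 1)⁻¹ := by positivity
  have hflm := measurable_fluctuationE_clamp hE ht (n := n N) (mesoRadius (n N))
  have horb : ∀ r ∈ Set.Icc 0 t, ∀ z ∈ (Φ N).good,
      IntervalIntegrable (fun r' => fluctuationE (mesoRadius (n N)) (ρ r') (θ r') (u r') ((Φ N).flow r' z)) volume 0 r ∧
      IntervalIntegrable (fun r' => cubicTail L ((Φ N).flow r' z)) volume 0 r :=
    fun r hr z hz => intervalIntegrable_fluctuationE_cubicTail_orbit hE ht (Φ N) hz le_rfl hr.1 hr.2 (mesoRadius (n N)) L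
  have hcrude : ∀ r ∈ Set.Icc 0 t, ∀ w : Config (n N) (Fin 3) T3,
      fluctuationE (mesoRadius (n N)) (ρ r) (θ r) (u r) w ≤ 2 + kineticPP w :=
    fun r _ w => fluctuationE_le hn0 hℓ0 hℓh _ _ _ w
  have hdN : 0 ≤ dd N := by simp only [hdd_def]; positivity
  have hdefW : ∀ z ∈ G' N, z ∈ (Φ N).good → packCapOn (Φ N) z (Set.Icc 0 t) (mesoRadius (n N)) σ ηP ∧
      ∀ k : ℕ, k < ι N → |momDefect σ (Φ N) z (mesoRadius (n N)) 0 ((k + 1) * (t / ι N)) (lamRow θ u)| ≤ dd N ∧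
        |enDefect σ (Φ N) z (mesoRadius (n N)) 0 ((k + 1) * (t / ι N)) (lam4Row θ)| ≤ dd N := by
    intro z hz hzg
    obtain ⟨hpack, hwin, -⟩ := hGz z hz hzg
    exact ⟨hpack, fun k hk => hwin k hk⟩
  have hdefC : ∀ z ∈ G' N, z ∈ (Φ N).good → packCapOn (Φ N) z (Set.Icc 0 t) (mesoRadius (n N)) σ ηP ∧
      ∀ j : ℕ, j < ι N → |momDefect σ (Φ N) z (mesoRadius (n N)) (j * (t / ι N)) (t / ι N)
          (fun r y => (j * (t / ι N) + t / ι N - r) • lamRow θ u r y)| ≤ dd N ∧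
        |enDefect σ (Φ N) z (mesoRadius (n N)) (j * (t / ι N)) (t / ι N)
          (fun r y => (j * (t / ι N) + t / ι N - r) * lam4Row θ r y)| ≤ dd N := by
    intro z hz hzg
    obtain ⟨hpack, -, hcell⟩ := hGz z hz hzg
    exact ⟨hpack, fun j hj => hcell j hj⟩
  have hdom : ∀ r ∈ Set.Icc 0 t, ∫ z, fluctuationE (mesoRadius (n N)) (ρ r) (θ r) (u r) ((Φ N).flow r z) ∂P N ≤
      β * (((∫ x, ρ r x * (Real.log (ρ r x) + gChem σ (ρ r x) - 3 / 2 * Real.log (2 * Real.pi * θ r x) - 3 / 2)) -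
        ∫ z, logProfileObs σ ρ θ u r ((Φ N).flow r z) ∂P N) + κ₁) := fun r hr => (heppN r hr).2.2
  -- the grid inequalities and the Grönwall step
  obtain ⟨hDint, hinc⟩ := hgi (Φ N) hn0 (P N) (hac N) hint hmeas hCX.le hCXb' hK1 hK2 hKm hℓ0 hℓh hL1 hωN hmod hflm horb hcrude hTm
    hTl0 htailN (G' N) (hG'm N) hdN hιN hdefW hβ0.le hκ₁0.le hdom
  have hcell := hgc (Φ N) hn0 (P N) (hac N) hint hmeas hCX.le hCXb' hK1 hK2 hKm hℓ0 hℓh hC3 hcubN (G' N) (hG'm N) hdN hιN hdefC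
  -- abbreviations of the `N`-dependent scalars
  set I : ℝ := ∫ z in (G' N)ᶜ, (1 + kineticPP z) ∂P N with hI_def
  set EK : ℝ := ∫ z, kineticPP z ∂P N with hEK_def
  set τN : ℝ := t / ι N with hτ_def
  set AA : ℝ := max 0 ((∫ x, ρ 0 x * (Real.log (ρ 0 x) + gChem σ (ρ 0 x) - 3 / 2 * Real.log (2 * Real.pi * θ 0 x) - 3 / 2)) -
      ∫ z, logProfileObs σ ρ θ u 0 ((Φ N).flow 0 z) ∂P N) + Cgi * (1 + L) * β * κ₁ * t + Cgi * t * Tl + 2 * dd N +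
      6 * t * ((ι N : ℝ) + 1)⁻¹ * (1 + EK) + 2 * CX * I + Cgi * t * pG N with hAA_def
  set ee : ℝ := Cgc * τN ^ 2 + 2 * dd N + Cgc * τN * (τN * (1 + EK) + τN * C3) + 2 * CX * τN * I with hee_def
  have hEK0 : 0 ≤ EK := integral_nonneg fun z => (hnn z).2
  have hI0 : 0 ≤ I := setIntegral_nonneg (hG'm N).compl fun z _ => by linarith [(hnn z).2]
  have hτ0 : 0 ≤ τN := by simp only [hτ_def]; positivity
  have hpG0 : 0 ≤ pG N := ENNReal.toReal_nonneg
  have hAA0 : 0 ≤ AA := by simp only [hAA_def]; positivity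
  have hee0 : 0 ≤ ee := by simp only [hee_def]; positivity
  have hgron := gronwall_cells (D := fun r => (∫ x, ρ r x * (Real.log (ρ r x) + gChem σ (ρ r x) -
      3 / 2 * Real.log (2 * Real.pi * θ r x) - 3 / 2)) - ∫ z, logProfileObs σ ρ θ u r ((Φ N).flow r z) ∂P N)
    (e := fun _ => ee) hιN ht0 hβ'0 hAA0 (E := (ι N : ℝ) * ee) (by positivity) hDint (fun j _ => hee0)
    (by rw [Finset.sum_const, Finset.card_range, nsmul_eq_mul]) (fun k hk => ?_) (fun j hj => ?_)
  rotate_left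
  · -- increments
    have h := hinc k hk
    simp only [hAA_def, hβ'_def, hI_def, hEK_def, hpG_def]
    simp only [hTl_def] at h ⊢
    convert h using 2
  · -- cells
    have h := hcell j hj
    simp only [hee_def, hτ_def, hI_def, hEK_def]
    convert h using 2
  ------------------------------------------------------------------
  -- the final bookkeeping
  ------------------------------------------------------------------
  have hD : H t - ∫ z, logProfileObs σ ρ θ u t ((Φ N).flow t z) ∂P N ≤ (AA + β' * ((ι N : ℝ) * ee)) * X := by
    simpa only [hH_def, hX_def] using hgron
  have hIle : I ≤ (1 + M') * pG N + CK / M' := hKset _ (hG'm N).compl M' hM'0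
  have hιτ : (ι N : ℝ) * τN = t := by
    have : (ι N : ℝ) ≠ 0 := by exact_mod_cast hιN.ne'
    rw [hτ_def]; field_simp
  have eD0 : max 0 ((∫ x, ρ 0 x * (Real.log (ρ 0 x) + gChem σ (ρ 0 x) - 3 / 2 * Real.log (2 * Real.pi * θ 0 x) - 3 / 2)) -
      ∫ z, logProfileObs σ ρ θ u 0 ((Φ N).flow 0 z) ∂P N) = D0 N := by simp only [hD0_def, hH_def]
  set J : ℝ := (1 + M') * pG N + CK / M' with hJ_def
  set AAu : ℝ := D0 N + Cgi * (1 + L) * β * κ₁ * t + Cgi * t * Tl + 2 * dd N + 6 * t * ((ι N : ℝ) + 1)⁻¹ * (1 + CK) +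
      2 * CX * J + Cgi * t * pG N with hAAu_def
  set EEu : ℝ := Cgc * t * τN + 2 * ((ι N : ℝ) * dd N) + Cgc * t * (τN * (1 + CK) + τN * C3) + 2 * CX * t * J with hEEu_def
  have hAAle : AA ≤ AAu := by
    rw [hAA_def, eD0, hAAu_def]
    have h1 : 6 * t * ((ι N : ℝ) + 1)⁻¹ * (1 + EK) ≤ 6 * t * ((ι N : ℝ) + 1)⁻¹ * (1 + CK) :=
      mul_le_mul_of_nonneg_left (by linarith only [hKle]) (by positivity)
    have h2 : 2 * CX * I ≤ 2 * CX * J := mul_le_mul_of_nonneg_left hIle (by positivity)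
    linarith only [h1, h2]
  have hEEle : (ι N : ℝ) * ee ≤ EEu := by
    have hι0 : (0 : ℝ) ≤ ι N := Nat.cast_nonneg _
    have e1 : (ι N : ℝ) * ee = Cgc * ((ι N : ℝ) * τN) * τN + 2 * ((ι N : ℝ) * dd N) +
        Cgc * ((ι N : ℝ) * τN) * (τN * (1 + EK) + τN * C3) + 2 * CX * ((ι N : ℝ) * τN) * I := by rw [hee_def]; ring
    rw [e1, hιτ, hEEu_def]
    have h1' : τN * (1 + EK) ≤ τN * (1 + CK) := mul_le_mul_of_nonneg_left (by linarith only [hKle]) hτ0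
    have h1 : Cgc * t * (τN * (1 + EK) + τN * C3) ≤ Cgc * t * (τN * (1 + CK) + τN * C3) :=
      mul_le_mul_of_nonneg_left (by linarith only [h1']) (by positivity)
    have h2 : 2 * CX * t * I ≤ 2 * CX * t * J := mul_le_mul_of_nonneg_left hIle (by positivity)
    linarith only [h1, h2]
  have hkey : X * AAu + X * (β' * EEu) = R N + Cgi * (1 + L) * β * κ₁ * t * X + Cgi * t * Tl * X + cG * (CK / M') := by
    simp only [hR_def, hAAu_def, hEEu_def, hJ_def, hcG_def]
    ring
  have hfin : (AA + β' * ((ι N : ℝ) * ee)) * X ≤ κ := by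
    calc (AA + β' * ((ι N : ℝ) * ee)) * X ≤ (AAu + β' * EEu) * X := by
          refine mul_le_mul_of_nonneg_right ?_ hX0.le
          exact add_le_add hAAle (mul_le_mul_of_nonneg_left hEEle hβ'0)
      _ = X * AAu + X * (β' * EEu) := by ring
      _ = R N + Cgi * (1 + L) * β * κ₁ * t * X + Cgi * t * Tl * X + cG * (CK / M') := hkey
      _ ≤ κ / 2 + κ / 8 + κ / 8 + κ / 8 := by linarith only [hRN, hκ₁small, hLsmall', hM'small]
      _ ≤ κ := by linarith only [hκ.le]
  linarith only [hD, hfin]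

end Summit.AtomisticToContinuum.HydrodynamicLimit.Theorems.NearConstantShortTimeHL

end
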